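import Mathlib
import Summits.NavierStokesRegularity.NavierStokesRegularity.Theorems.HeteroclinicTriggerChainTriggerChainFrontStepSeededTruncation
import Summits.NavierStokesRegularity.NavierStokesRegularity.Theorems.HeteroclinicTriggerChainTriggerChainFrontStepForcedArc
import HarnessLib

/-!
# `HeteroclinicTriggerChain` — crux `TriggerChainFrontStep` (item stmt-NavierStokesRegularity-22785):
  the post-ignition HOP of the seeded two-shell truncation (capture with the upper trigger under control)

Blueprint item 2 (hop map), first end-to-end statement for the lead's seeded truncation
`x′ = −eu² − βuv`, `u′ = exu − euy`, `y′ = eu² − e′v²`, `v′ = βxu + e′yv` (`g = e`, energy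
`x² + u² + y² + v²` conserved): after ignition (trigger energy `u(0)²` above an explicit threshold) the
receiver CAPTURES the energy (`x − y ≤ −L`) within an explicit time, while the upper trigger stays under
its Grönwall envelope `|v| ≤ |v(0)|e^{e′T} + (β/e′)(e^{e′T} − 1)` on the window — so the arc forcing
`φ = 2βV + e′V²` is explicit in `(β, v(0), T)` — and at capture the receiver holds at least
`(x(0) + y(0) + L − φt)/2`. Composition of `heteroclinicTriggerChain_trunc_capture` (forced arc, this
crux's ForcedArc file), `heteroclinicTriggerChain_trunc_energy` (SeededTruncation file) and Mathlib's
`norm_le_gronwallBound_of_norm_deriv_right_le`. The delay phase before ignition (two-sided exponential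
growth of the trigger from the seed) is a separate lemma (sibling seat); premature ignition = the size of
`V` at capture.

HONEST FRAMING: elementary real analysis of a four-dimensional quadratic ODE; helper for the crux (no stub
credit); nothing here is a statement about the Navier–Stokes equations; no summit, rung or crux is proved.
-/

noncomputable section

set_option linter.dupNamespace false

open Real Set

namespace Summit.NavierStokesRegularity.NavierStokesRegularity.Theorems

/-- **Post-ignition hop of the seeded two-shell truncation: the upper trigger stays under its Grönwall
envelope and the receiver captures.** For the lead's truncation with `g = e`, `e, e′ > 0`, `β ≥ 0` and
energy `x² + u² + y² + v² ≤ 1` (conserved): on a window `[0,T]` the upper trigger obeys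
`|v(t)| ≤ V` for any `V ≥ gronwallBound |v(0)| e′ β T = |v(0)|e^{e′T} + (β/e′)(e^{e′T} − 1)`
(`|v′| ≤ e′|v| + β`), hence the arc forcing is `φ = 2βV + e′V²` (`|x − y| ≤ 2`, `|u| ≤ 1`), and under the
energy conditions of `heteroclinicTriggerChain_forcedArc_capture` (ignited trigger `2u(0)² ≥ 2m + 12φT`,
capture level `L² + 2m + 12φT ≤ (x(0)−y(0))² + 2u(0)²`, `φ < 2em`, window
`(x(0)−y(0)+L)/(2em−φ) ≤ T`) the receiver captures, `x − y ≤ −L`, within `(x(0)−y(0)+L)/(2em−φ)`, at a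
time where moreover `2y ≥ x(0) + y(0) + L − φ·t` (the sum `x + y` drifts by at most `φ` per unit time).
[folklore] -/
theorem heteroclinicTriggerChain_trunc_hop_capture (e e' β : ℝ) (he : 0 < e) (he' : 0 < e') (hβ : 0 ≤ β)
    (x u y v : ℝ → ℝ)
    (hx : ∀ t, HasDerivAt x (-(e * u t ^ 2) - β * u t * v t) t)
    (hu : ∀ t, HasDerivAt u (e * x t * u t - e * u t * y t) t)
    (hy : ∀ t, HasDerivAt y (e * u t ^ 2 - e' * v t ^ 2) t)
    (hv : ∀ t, HasDerivAt v (β * x t * u t + e' * y t * v t) t)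
    (hE : x 0 ^ 2 + u 0 ^ 2 + y 0 ^ 2 + v 0 ^ 2 ≤ 1)
    {T V φ m L : ℝ} (hT : 0 ≤ T) (hV : gronwallBound |v 0| e' β T ≤ V)
    (hφ : φ = 2 * β * V + e' * V ^ 2)
    (hφm : φ < 2 * e * m) (hu0 : 2 * m + 12 * φ * T ≤ 2 * u 0 ^ 2)
    (hL : L ^ 2 + 2 * m + 12 * φ * T ≤ (x 0 - y 0) ^ 2 + 2 * u 0 ^ 2)
    (hTT : ((x 0 - y 0) + L) / (2 * e * m - φ) ≤ T) :
    (∀ t ∈ Icc 0 T, |v t| ≤ V) ∧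
      ∃ t ∈ Icc 0 (max 0 (((x 0 - y 0) + L) / (2 * e * m - φ))),
        x t - y t ≤ -L ∧ x 0 + y 0 + L - φ * t ≤ 2 * y t := by
  -- a priori bounds from the energy
  have hEt : ∀ t, x t ^ 2 + u t ^ 2 + y t ^ 2 + v t ^ 2 ≤ 1 := fun t => by
    rw [heteroclinicTriggerChain_trunc_energy e e e' β x u y v hx hu hy hv t]; exact hE
  have hx1 : ∀ t, |x t| ≤ 1 := fun t =>
    abs_le.2 ⟨by nlinarith [hEt t, sq_nonneg (u t), sq_nonneg (y t), sq_nonneg (v t)],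
      by nlinarith [hEt t, sq_nonneg (u t), sq_nonneg (y t), sq_nonneg (v t)]⟩
  have hu1 : ∀ t, |u t| ≤ 1 := fun t =>
    abs_le.2 ⟨by nlinarith [hEt t, sq_nonneg (x t), sq_nonneg (y t), sq_nonneg (v t)],
      by nlinarith [hEt t, sq_nonneg (x t), sq_nonneg (y t), sq_nonneg (v t)]⟩
  have hy1 : ∀ t, |y t| ≤ 1 := fun t =>
    abs_le.2 ⟨by nlinarith [hEt t, sq_nonneg (x t), sq_nonneg (u t), sq_nonneg (v t)],
      by nlinarith [hEt t, sq_nonneg (x t), sq_nonneg (u t), sq_nonneg (v t)]⟩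
  -- Grönwall envelope of the upper trigger on [0, T]
  have hvV : ∀ t ∈ Icc 0 T, |v t| ≤ V := by
    intro t ht
    have hg := norm_le_gronwallBound_of_norm_deriv_right_le (f := v)
      (f' := fun t => β * x t * u t + e' * y t * v t) (δ := |v 0|) (K := e') (ε := β) (a := 0) (b := T)
      (fun s _ => (hv s).continuousAt.continuousWithinAt) (fun s _ => (hv s).hasDerivWithinAt)
      (by simp) (fun s _ => by
        rw [Real.norm_eq_abs, Real.norm_eq_abs]
        have h1 : |β * x s * u s| ≤ β := by
          rw [abs_mul, abs_mul, abs_of_nonneg hβ]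
          calc β * |x s| * |u s| ≤ β * 1 * 1 := by
                gcongr
                · exact hx1 s
                · exact hu1 s
            _ = β := by ring
        have h2 : |e' * y s * v s| ≤ e' * |v s| := by
          rw [abs_mul, abs_mul, abs_of_nonneg he'.le]
          calc e' * |y s| * |v s| ≤ e' * 1 * |v s| := by gcongr; exact hy1 s
            _ = e' * |v s| := by ring
        calc |β * x s * u s + e' * y s * v s| ≤ |β * x s * u s| + |e' * y s * v s| := abs_add_le _ _
          _ ≤ e' * |v s| + β := by linarith) t ht
    rw [Real.norm_eq_abs, sub_zero] at hg
    exact hg.trans ((gronwallBound_mono (abs_nonneg _) hβ he'.le ht.2).trans hV)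
  refine ⟨hvV, ?_⟩
  -- capture through the forced arc, M = 2
  have hDM : ∀ t ∈ Icc 0 T, |x t - y t| ≤ 2 := fun t _ =>
    (abs_sub _ _).trans (by linarith [hx1 t, hy1 t])
  have huM : ∀ t ∈ Icc 0 T, |u t| ≤ 2 := fun t _ => (hu1 t).trans (by norm_num)
  have hφ' : φ = β * 2 * V + e' * V ^ 2 := by rw [hφ]; ring
  have hu0' : 2 * m + 6 * 2 * φ * T ≤ 2 * u 0 ^ 2 := by linarith
  have hL' : L ^ 2 + 2 * m + 6 * 2 * φ * T ≤ (x 0 - y 0) ^ 2 + 2 * u 0 ^ 2 := by linarith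
  obtain ⟨t, ht, hcap⟩ := heteroclinicTriggerChain_trunc_capture e e' β he he'.le hβ x u y v hx hu hy hT
    hφ' hDM huM hvV hφm hu0' hL' hTT
  refine ⟨t, ht, hcap, ?_⟩
  -- the sum x + y drifts by at most φ per unit time on [0, t] ⊆ [0, T]
  have htT : t ≤ T := ht.2.trans (max_le hT hTT)
  have hV0 : 0 ≤ V := (abs_nonneg _).trans (hvV 0 ⟨le_rfl, hT⟩)
  have hSum : ∀ s, HasDerivAt (fun r => x r + y r) (-(β * u s * v s) - e' * v s ^ 2) s := by
    intro s
    refine ((hx s).add (hy s)).congr_deriv ?_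
    ring
  have hbound : ∀ s ∈ Ico 0 t, ‖-(β * u s * v s) - e' * v s ^ 2‖ ≤ φ := by
    intro s hs
    have hs' : s ∈ Icc 0 T := ⟨hs.1, hs.2.le.trans htT⟩
    have h1 : |β * u s * v s| ≤ β * V := by
      rw [abs_mul, abs_mul, abs_of_nonneg hβ]
      calc β * |u s| * |v s| ≤ β * 1 * V := by
            gcongr
            · exact hu1 s
            · exact hvV s hs'
        _ = β * V := by ring
    have h2 : |e' * v s ^ 2| ≤ e' * V ^ 2 := by
      rw [abs_mul, abs_of_nonneg he'.le, abs_pow]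
      exact mul_le_mul_of_nonneg_left (pow_le_pow_left₀ (abs_nonneg _) (hvV s hs') 2) he'.le
    rw [Real.norm_eq_abs]
    calc |-(β * u s * v s) - e' * v s ^ 2| ≤ |-(β * u s * v s)| + |e' * v s ^ 2| := abs_sub _ _
      _ = |β * u s * v s| + |e' * v s ^ 2| := by rw [abs_neg]
      _ ≤ β * V + e' * V ^ 2 := by linarith
      _ ≤ φ := by rw [hφ]; nlinarith
  have hdrift := norm_image_sub_le_of_norm_deriv_right_le_segment
    (fun s _ => (hSum s).continuousAt.continuousWithinAt) (fun s _ => (hSum s).hasDerivWithinAt)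
    hbound t (right_mem_Icc.2 ht.1)
  rw [Real.norm_eq_abs, sub_zero] at hdrift
  have h := (abs_le.1 hdrift).1
  linarith

end Summit.NavierStokesRegularity.NavierStokesRegularity.Theorems

end
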